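import Summits.BirchSwinnertonDyer.BirchSwinnertonDyer.Theorems.SemiOrdinaryEisensteinDescentEisensteinKernelAtThreeTowerFreeOdd
import Summits.BirchSwinnertonDyer.BirchSwinnertonDyer.Theorems.SemiOrdinaryEisensteinDescentWildSplitEisensteinInclusionAtThreeTight
import Summits.BirchSwinnertonDyer.BirchSwinnertonDyer.Theorems.UniversalToricDescentWildSplitFrameAtThreeOddOfPrintOfEngine
import HarnessLib

/-!
# Route `SemiOrdinaryEisensteinDescent`: the `closes` kernel‴ (item 24697, PROVED) with its crux #2′ antecedent E′
# (`WildSplitEisensteinInclusionAtThreeRestricted`, 24155, Λ-adic) WEAKENED to the T = 0 shadow `E_𝟙′` — the restricted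
# value-at-𝟙 residual — in the CURRENT binders (tower-free Ko′, printed-inputs package, `R₀`-frame at odd `d_K`, PT1):
# `PUB → E_𝟙′ → Ko′ → package → frame-odd → PT1 → Z ⟹ WAllExclAddWildRankOneSurj`, and with 24475 CLOSED
# `PUB → E_𝟙′ → Ko′ → package → PT1 → Z ⟹ leaf`
# (cell `pub/bsd-wall`, width seat `bsd-wall-soed-p1-w3` g7, `--supports stmt-BirchSwinnertonDyer-24155`, helper)

WHY. The landed kernel‴ `semiOrdinaryEisensteinDescent_eisensteinKernelAtThreeTowerFreeOdd_proof` (w3 g6, p596688; the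
route's `closes` binder `hK`, item 24697 CLOSED) consumes crux #2′ E′ at exactly one place: the Friedberg–Hoffstein datum's
frame `(κ, γ, 𝔭, 𝔭′)`, to obtain `f ∈ (𝓛)·R₀⟦T⟧` for a characteristic generator `f` of `X_(∅,0)` at `𝔭′` and from it
ONLY the T = 0 inequality `2·ord₃(log_ω P / c) ≤ ord₃ f(𝟙)` (`Supersingular.two_mul_valuation_le_of_mem_span`). That
inequality is, verbatim, what the restricted value-at-𝟙 residual `E_𝟙′` asserts (`‖f(𝟙)‖₃ ≤ ‖𝓛(𝟙)‖₃` for every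
generator, at every frame of every such datum with `X_(∅,0)` torsion), read through the unit value display by w2 g4's
`WildSplitEisensteinInclusionAtThreeTight.imcLowerLe_iff_forall_norm_constantCoeff_le`. w2 g4 proved the analogous
weakening for the OLD kernel (`Tight.wAllExclAddWildRankOneSurj_of_valueAtOneV`: binders Ko / V / C / NT, all ASIDE since
SOED revs 9–14); this file does it for the CURRENT kernel‴, so that a future restate «crux #2′ ↦ E_𝟙′» (the pen's option
since w2 g4's TIGHT-E memo, evidence #1 on 24155) re-binds `closes` at zero glue cost. `E_𝟙′` is the stub
`stub_valueAtOneRestricted` of the registered line `birth` on 24155 (soed-p1-w2 g8, skeleton cf6952029d97d119).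

CONTENTS (0 definitions, 0 named facts, 0 `sorry`; every crux / fact is an ANTECEDENT):
* §1 `wAllExclAddWildRankOneSurj_of_valueAtOneRestricted_of_koTowerFree_of_frameOdd_of_poitouTate` —
  `PublishedInputsWildThree → E_𝟙′ → WildKolyvaginUpperAtThreeTowerFree → WildSplitPrintedInputsAtThree →
  WildSplitFrameAtThreeOddOfPrint → PoitouTateSelmerStructureDualityFact → WildRankZeroTwistAtThree → WAllExclAddWildRankOneSurj`
  (kernel‴'s binders with `hE'` ↦ `hE1`). Proof = p596688 VERBATIM except the lower-socket step, which reads `E_𝟙′`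
  through `imcLowerLe_iff_forall_norm_constantCoeff_le` at the control count's CTL₀.
* §2 `…_of_valueAtOneRestricted_of_koTowerFree_of_package_of_poitouTate` — the same with the frame item DISCHARGED by UTD's
  CLOSED 24475 (`Theorems.wildSplitFrameAtThreeOddOfPrint_proof`, fed by the package's Hsieh / BDP conjuncts):
  `PUB → E_𝟙′ → Ko′ → package → PT1 → Z → leaf`.
* (no §3: kernel‴'s own statement — item 24697's text — follows from §1 through `E′ ⟹ E_𝟙′`, p588074
  `WildSplitEisensteinInclusionAtThreeRankOneRestriction.valueAtOneRestricted_of_restricted`; it is already landed as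
  `semiOrdinaryEisensteinDescent_eisensteinKernelAtThreeTowerFreeOdd_proof` and is not restated here, gate dedup.landed on p601567.)

HONEST FRAMING: CONDITIONAL on every displayed antecedent — `E_𝟙′` is the research content of crux #2′ (= the «≥» half of
the 3-part of #Ш(E/K) in GZ–BSD at Friedberg–Hoffstein data on the onto wild r₁ cell; no engine in print: walls W1–W3 of
`Cruxes/WildSplitEisensteinInclusionAtThree/Lines/birth-dead*.md`), Ko′ rests on J′ (24702, research), Z is the open
rank-zero wild leaf, the rest is print; theorems only; closes nothing; BSD₃ for no curve.

References: [JetchevSkinnerWan2017] Thm. 3.3.1, §7.4.1 (arXiv:1512.06894 pp. 11, 30); [LiuZhangZhang2018] Thm 1.5.1/1.5.3;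
[MilneADT2006] I Thm. 4.10(b); [Castella2018] Thm. 2.3, §5; [GrossZagier1986] I.(6.3), V §2; [FriedbergHoffstein1995] Thm. B;
[McCallumLMS1991] §3; [Kolyvagin1990] Thm. A; [Hsieh2014] Thm. A; [BertoliniDarmonPrasanna2013] Thm. 5.13.
-/

noncomputable section

open scoped Classical NumberField

set_option linter.dupNamespace false -- `Summit.BirchSwinnertonDyer.BirchSwinnertonDyer.Theorems.…` (summit = sub, D-0017)
set_option autoImplicit false

namespace Summit.BirchSwinnertonDyer.BirchSwinnertonDyer.Theorems.EisensteinKernelAtThreeTowerFreeOddOfValueAtOne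

open WeierstrassCurve NumberField IsDedekindDomain Field PowerSeries
  Literature.NumberTheory.EllipticCurves
  Literature.NumberTheory.EllipticCurves.ModularForms
  Literature.NumberTheory.EllipticCurves.Rank1Residual
  Literature.NumberTheory.EllipticCurves.KrizLi2019
  Literature.NumberTheory.GaloisCohomology
  Summit.BirchSwinnertonDyer.Rank1Residual
  Summit.BirchSwinnertonDyer.Rank1Residual.Additive
  Summit.BirchSwinnertonDyer.Rank1Residual.X11b
  Summit.BirchSwinnertonDyer.Rank1Residual.X11b.AcSelmer
  Summit.BirchSwinnertonDyer.Rank1Residual.X11b.Halves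
  Summit.BirchSwinnertonDyer.BirchSwinnertonDyer.Theses.SemiOrdinaryEisensteinDescent
  Summit.BirchSwinnertonDyer.BirchSwinnertonDyer.Theorems

/-! ### §1 Kernel‴ with E′ weakened to `E_𝟙′` -/

/-- **`PublishedInputsWildThree → E_𝟙′ → WildKolyvaginUpperAtThreeTowerFree → WildSplitPrintedInputsAtThree →
WildSplitFrameAtThreeOddOfPrint → PoitouTateSelmerStructureDualityFact → WildRankZeroTwistAtThree → WAllExclAddWildRankOneSurj`**
— the route's kernel‴ (item 24697, p596688) with its crux #2′ antecedent `WildSplitEisensteinInclusionAtThreeRestricted` (Λ-adic)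
replaced by the restricted value-at-𝟙 residual `E_𝟙′` (`hE1`, p588074's display: at every frame of every Heegner datum of the
cell with `L(E^(d_K),1) ≠ 0`, `P = y_K` non-torsion and `X_(∅,0)` torsion at `𝔭′`, every characteristic generator `f` has
`‖f(𝟙)‖₃ ≤ ‖𝓛(𝟙)‖₃`). Jetchev–Skinner–Wan's §7.4 assembly at the wild split `3` without tower split: Friedberg–Hoffstein
field (`2` and all of `N(E)` split: odd `d_K ≠ -3`), Heegner point, Gross–Zagier, Kolyvagin, frame `(κ, γ, 𝔭, 𝔭′)`,
`R₀`-frame at `𝔭` from print with unit value forced by LZZ, `≤`-control + CTL₀ at `𝔭′` from PT1, `E_𝟙′` at the frame read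
through the value display (`WildSplitEisensteinInclusionAtThreeTight.imcLowerLe_iff_forall_norm_constantCoeff_le`) ⟹ lower
socket, Ko′ ⟹ upper socket, both at slack `v₃(c)` ⟹ p528981 with the rank-zero leaf. Every crux / fact is an
antecedent; closes nothing; BSD is not proved by this.
[cite: JetchevSkinnerWan2017, Thm. 3.3.1 and §7.4.1 (arXiv:1512.06894 pp. 11, 30)]
[cite: LiuZhangZhang2018, Thm 1.5.1 and Thm 1.5.3 (Duke Math. J. 167 pp. 748–749)] [cite: MilneADT2006, Ch. I, Thm. 4.10(b)]
[cite: GrossZagier1986, Thm. I.(6.3) and V.§2] [cite: FriedbergHoffstein1995, Thm. B] -/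
theorem wAllExclAddWildRankOneSurj_of_valueAtOneRestricted_of_koTowerFree_of_frameOdd_of_poitouTate
    (hF : PublishedInputsWildThree)
    (hE1 : ∀ (W : WeierstrassCurve ℚ) [W.IsElliptic] [W.IsGloballyMinimal] (N : ℕ) [NeZero N] (K : Type) [Field K] [NumberField K] (Dt : Literature.NumberTheory.EllipticCurves.ModularForms.ModularParametrizationData W N) (H : Literature.NumberTheory.EllipticCurves.HeegnerDatum N (NumberField.discr K)) (ι : K →+* ℂ) (P : (W.baseChange K).toAffine.Point), Summit.BirchSwinnertonDyer.Rank1Residual.Additive.ClassO6 W 3 → W.HasSurjectiveModNGaloisRep 3 → W.analyticRank = 1 → W.conductorNorm ℤ = N → Literature.NumberTheory.EllipticCurves.IsImaginaryQuadratic K → Literature.NumberTheory.EllipticCurves.SatisfiesHeegnerHypothesis N K → (W.quadraticTwist (NumberField.discr K : ℚ)).entireLFunction 1 ≠ 0 → (WeierstrassCurve.Affine.Point.map ι.toRatAlgHom) P = Literature.NumberTheory.EllipticCurves.ModularForms.heegnerPointComplex Dt H → ¬ IsOfFinAddOrder P → ∀ (κ : Literature.NumberTheory.EllipticCurves.ZpExtension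 K 3), κ.IsAnticyclotomic → ∀ (γ : Field.absoluteGaloisGroup K) [Fact (κ.IsTopGenerator γ)] (𝔭 : IsDedekindDomain.HeightOneSpectrum (NumberField.RingOfIntegers K)), ((3 : ℕ) : NumberField.RingOfIntegers K) ∈ 𝔭.asIdeal → 𝔭.asIdeal.ramificationIdx (NumberField.RingOfIntegers ℚ) = 1 → 𝔭.asIdeal.inertiaDeg (NumberField.RingOfIntegers ℚ) = 1 → ∀ (𝔭' : IsDedekindDomain.HeightOneSpectrum (NumberField.RingOfIntegers K)), ((3 : ℕ) : NumberField.RingOfIntegers K) ∈ 𝔭'.asIdeal → 𝔭' ≠ 𝔭 → ∀ (ι' : PadicAlgCl 3 ≃+* ℂ), Summit.BirchSwinnertonDyer.BirchSwinnertonDyer.Theorems.SchneiderFree.BranchInducesPrime 3 ι' 𝔭 → ∀ (ΩK : ℂ) (Ωp : ℂ_[3]) (L : Literature.NumberTheory.EllipticCurves.UnrSeries 3), ΩK ≠ 0 → Ωp ≠ 0 → Literature.NumberTheory.EllipticCurves.IsBDPLFunction ι' 𝔭 κ γ Dt.f ΩK Ωp L → Module.IsTorsion (Literature.NumberTheory.EllipticCurves.IwasawaAlgebra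 3) (Summit.BirchSwinnertonDyer.Rank1Residual.X11b.AcSelmer.XAc (W.baseChange K) 3 κ 𝔭' ∅ γ) → ∀ (f : Literature.NumberTheory.EllipticCurves.IwasawaAlgebra 3), Summit.BirchSwinnertonDyer.Rank1Residual.X11b.AcSelmer.XAc.charIdeal (W.baseChange K) 3 κ 𝔭' ∅ γ = Ideal.span {f} → ‖((PowerSeries.constantCoeff f : ℤ_[3]) : ℚ_[3])‖ ≤ ‖((PowerSeries.constantCoeff L : Literature.NumberTheory.EllipticCurves.unrIntegers 3) : ℂ_[3])‖)
    (hKoly : WildKolyvaginUpperAtThreeTowerFree)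
    (hW : WildSplitPrintedInputsAtThree)
    (hS : WildSplitFrameAtThreeOddOfPrint)
    (hPT : PoitouTateSelmerStructureDualityFact)
    (hZ : WildRankZeroTwistAtThree) :
    Summit.BirchSwinnertonDyer.WAllExclAddWildRankOneSurj := by
  unfold Summit.BirchSwinnertonDyer.WAllExclAddWildRankOneSurj
  intro W _ _ hncm hO6 hsurj hr
  obtain ⟨hH, hB, hLZZ⟩ := hW
  obtain ⟨hGZ, hKo, hGZK, hmod, hmodP, -, hGZ73, hFH, hpar, hHP⟩ := hF
  haveI hN0 : NeZero (W.conductorNorm ℤ) := ⟨W.conductorNorm_pos_holds.ne'⟩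
  -- (a) DATA. parity: `r_an = 1` is odd, so `w(E) = -1`
  have hw : W.rootNumber = -1 := by
    rcases W.rootNumber_eq_one_or with h | h
    · exfalso
      have heven : Even W.analyticRank := (hpar W).mpr h
      rw [hr] at heven
      exact Nat.not_even_one heven
    · exact h
  -- Friedberg–Hoffstein with auxiliary modulus `2`: Heegner for `N(E)`, `2` split, `L(E^{(d_K)},1) ≠ 0`
  obtain ⟨K, _, _, hK, -, hHN, hH2, hLt⟩ := hFH W hw 2 two_ne_zero 0
  have hodd : Odd (NumberField.discr K) := by
    have h8 := Literature.SatisfiesHeegnerHypothesis.discr_emod_eight hK.1 hH2 (dvd_refl 2)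
    rw [Int.odd_iff]; omega
  -- `3 ∣ N(E)` (additive) splits in `K`; hence `d_K ≠ -3`
  have h3N : 3 ∣ W.conductorNorm ℤ :=
    (W.dvd_conductorNorm_iff_not_hasGoodReductionAtPrime 3).mpr (not_good_of_addv W 3 hO6.2.1)
  have hsplit : SplitsIn K 3 := hHN 3 Nat.prime_three h3N
  have hd3 : NumberField.discr K ≠ -3 := by
    intro h
    exact Literature.SatisfiesHeegnerHypothesis.not_dvd_discr hK.1 hHN Nat.prime_three h3N
      (by rw [h]; norm_num)
  -- the Heegner point over `K` and its datum; non-torsion by Gross–Zagier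
  obtain ⟨P, Dt, H, ι, hP⟩ := hHP W K hK hHN
  have hL0 : W.entireLFunction 1 = 0 := entireLFunction_one_eq_zero_of_analyticRank_eq_one hr
  obtain ⟨-, hderiv⟩ := leadingLCoeff_eq_deriv_of_analyticRank_eq_one hr
  have hLK : LDerivEK W K ≠ 0 := by
    rw [lDerivEK_eq_deriv_mul W K hmod hL0]; exact mul_ne_zero hderiv hLt
  have hnt : ¬ IsOfFinAddOrder P :=
    (lDerivEK_ne_zero_iff_not_isOfFinAddOrder W (W.conductorNorm ℤ) K (hGZ _ W K) hK hHN
      ⟨Dt, H, ι, hP⟩).mp hLK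
  -- Kolyvagin: `rank E(K) = 1`, `Ш(E/K)` finite
  obtain ⟨hrk, hfin⟩ := hKo (W.conductorNorm ℤ) W K hK hHN ⟨Dt, H, ι, hP⟩ hnt
  -- a frame `(κ, γ, 𝔭)` and the other prime `𝔭′ ≠ 𝔭` above `3`
  obtain ⟨κ, γ, -, hκ, hγ, -⟩ := X11b.exists_anticyclotomic_generator_prime (p := 3) hK
  haveI : Fact (κ.IsTopGenerator γ) := ⟨hγ⟩
  obtain ⟨𝔭, h𝔭, he, hf⟩ := X11b.exists_degreeOnePrime_of_splitsIn K 3 hK.1 hsplit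
  obtain ⟨𝔭', hne, h𝔭', he', hf'⟩ := X11b.Three.exists_ne_degreeOne_prime hK.1 h𝔭 he hf
  -- (b) PLUMBING. the `R₀`-frame at `(κ, γ, 𝔭)` over the Friedberg–Hoffstein field (odd `d_K`) FROM PRINT, and its unit
  -- value, FORCED by the LZZ input (p594734 §1)
  obtain ⟨ι', hind, ΩK, Ωp, L, hΩK, hΩp, hBDP⟩ :=
    hS hH hB W (W.conductorNorm ℤ) K Dt hO6 rfl hK hHN hodd κ hκ γ 𝔭 h𝔭
  obtain ⟨u, hval⟩ := EisensteinKernelAtThreeRestrictedOfFrameOdd.exists_unit_hasValueAt_of_frame hLZZ W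
    (W.conductorNorm ℤ) K Dt H ι P hO6 rfl hK hHN hP hnt κ hκ γ 𝔭 h𝔭 he hf ι' hind hΩK hΩp hBDP
  -- the control INEQUALITY at `𝔭′` at slack `0` (CTL₀ included), from Poitou–Tate duality for Selmer structures ALONE
  have hctl : SchneiderFreeControlAtoms.AdditiveControlLeOnTreeAt 3 κ 𝔭' γ (embAt K 3 𝔭' h𝔭' he' hf') 0 P :=
    AdditiveRankOneControlLe.additiveControlLeOnTreeAt_of_poitouTate_of_heegner W 3 (by norm_num) hO6.2.1
      (W.conductorNorm ℤ) K (hPT K) Dt H ι P rfl hK hHN hP hnt (hKo _ W K) κ hκ γ 𝔭' h𝔭' he' hf'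
  obtain ⟨n, hn, hnle⟩ := hctl
  -- the value read through the logarithm at `𝔭′` (rank one: `(log_{𝔭′} P)² = (log_𝔭 P)²`)
  have hval' : L.HasValueAt 0 ((((u : unrIntegers 3) : unrIntegers 3) : ℂ_[3]) *
      (algebraMap ℚ_[3] ℂ_[3]
        (logOmega W 3 (embAt K 3 𝔭' h𝔭' he' hf') P / (Dt.c : ℚ_[3]))) ^ 2) :=
    (SchneiderFreeAdditiveX3.hasValueAt_sq_logOmega_embAt_iff_of_rank_one W 3 hK.1 hrk h𝔭 he hf
      h𝔭' he' hf' P _ _ L).mpr hval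
  -- the LOWER socket at slack `v₃(c)` at the frame `(κ, 𝔭′, γ, embAt 𝔭′)` — from `E_𝟙′` (T = 0 only), read through the
  -- unit value display at the control count's CTL₀ (w2 g4's `imcLowerLe_iff_forall_norm_constantCoeff_le`)
  have hc0 : Dt.c ≠ 0 := Dt.maninConstant_ne_zero_holds
  have hlog : logOmega W 3 (embAt K 3 𝔭' h𝔭' he' hf') P ≠ 0 := X11b.R1.logOmega_ne_zero W 3 _ hnt
  have hlow : SchneiderFree.AdditiveIMCLowerBDPOnTreeLeAt 3 κ 𝔭' γ (embAt K 3 𝔭' h𝔭' he' hf')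
      (padicValNat 3 Dt.c.natAbs) P :=
    (WildSplitEisensteinInclusionAtThreeTight.imcLowerLe_iff_forall_norm_constantCoeff_le hc0 hlog hn u hval').mpr
      (fun f hfI ↦ hE1 W (W.conductorNorm ℤ) K Dt H ι P hO6 hsurj hr rfl hK hHN hLt hP hnt κ hκ γ 𝔭 h𝔭 he hf 𝔭' h𝔭'
        hne ι' hind ΩK Ωp L hΩK hΩp hBDP hn.1 f hfI)
  -- STEP L at the Manin slack: the link consumes control ONLY as `≤` (utd-p3 g6, p593079 §3)
  have hlo : SchneiderFree.IndexLowerBoundLeAt W 3 K P (padicValNat 3 Dt.c.natAbs) :=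
    AdditiveRankOneControlLe.indexLowerBoundLeAt_of_imcLowerLe_of_controlLe_zero rfl hK hHN hfin hlow
      ⟨n, hn, hnle⟩
  -- the UPPER socket at slack `v₃(c)` IS the TOWER-FREE Kolyvagin crux `Ko′` (`d_K` odd, `≠ -3`; onto mod `3` only)
  have hupI : SchneiderFree.Upper.IndexUpperBoundLeAt W 3 K P (padicValNat 3 Dt.c.natAbs) :=
    hKoly W (W.conductorNorm ℤ) K Dt H ι P hO6 hsurj hr rfl hK hHN hLt hP hnt hodd hd3
  -- (c) TERMINAL STEP: a globally minimal model of the twist, then p528981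
  have hD0 : (NumberField.discr K : ℚ) ≠ 0 := by exact_mod_cast NumberField.discr_ne_zero K
  haveI : (W.quadraticTwist (NumberField.discr K : ℚ)).IsElliptic := W.isElliptic_quadraticTwist hD0
  obtain ⟨Cd, hCd⟩ := hasGlobalMinimalModel_rat_holds (W.quadraticTwist (NumberField.discr K : ℚ))
  haveI : (Cd • W.quadraticTwist (NumberField.discr K : ℚ)).IsGloballyMinimal := hCd
  exact SchneiderFree.Exact.bsdp_three_of_exactIndexManin_of_wAllExclAddWildRankZero hGZ hKo hGZK hmod
    hGZ73 hZ W hO6 hsurj hr (W.conductorNorm ℤ) K Dt H ι P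
    (Cd • W.quadraticTwist (NumberField.discr K : ℚ)) rfl hK hodd hHN hLt hP ⟨Cd, rfl⟩ hlo hupI

/-! ### §2 The same with the frame item 24475 (CLOSED) discharged by name -/

/-- **`PublishedInputsWildThree → E_𝟙′ → WildKolyvaginUpperAtThreeTowerFree → WildSplitPrintedInputsAtThree →
PoitouTateSelmerStructureDualityFact → WildRankZeroTwistAtThree → WAllExclAddWildRankOneSurj`**: §1 with the `R₀`-frame item
`WildSplitFrameAtThreeOddOfPrint` (24475, CLOSED·proved by utd-s1 g0, p596578 over soed-p1-w2 g7's engine p595848) supplied by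
`Theorems.wildSplitFrameAtThreeOddOfPrint_proof`; its two print antecedents (Hsieh 2014 Thm A, BDP 2013) are the first two
conjuncts of the package. So, modulo print + PT1 + the rank-zero leaf Z, the onto wild rank-one leaf ⟸ {`E_𝟙′`, Ko′}: the
two T = 0 halves of the 3-part of #Ш(E/K) at Friedberg–Hoffstein data. CONDITIONAL; closes nothing; BSD for no curve.
[cite: JetchevSkinnerWan2017, Thm. 3.3.1 and §7.4.1 (arXiv:1512.06894 pp. 11, 30)] [cite: Hsieh2014, Thm. A]
[cite: BertoliniDarmonPrasanna2013, Thm. 5.13] -/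
theorem wAllExclAddWildRankOneSurj_of_valueAtOneRestricted_of_koTowerFree_of_package_of_poitouTate
    (hF : PublishedInputsWildThree)
    (hE1 : ∀ (W : WeierstrassCurve ℚ) [W.IsElliptic] [W.IsGloballyMinimal] (N : ℕ) [NeZero N] (K : Type) [Field K] [NumberField K] (Dt : Literature.NumberTheory.EllipticCurves.ModularForms.ModularParametrizationData W N) (H : Literature.NumberTheory.EllipticCurves.HeegnerDatum N (NumberField.discr K)) (ι : K →+* ℂ) (P : (W.baseChange K).toAffine.Point), Summit.BirchSwinnertonDyer.Rank1Residual.Additive.ClassO6 W 3 → W.HasSurjectiveModNGaloisRep 3 → W.analyticRank = 1 → W.conductorNorm ℤ = N → Literature.NumberTheory.EllipticCurves.IsImaginaryQuadratic K → Literature.NumberTheory.EllipticCurves.SatisfiesHeegnerHypothesis N K → (W.quadraticTwist (NumberField.discr K : ℚ)).entireLFunction 1 ≠ 0 → (WeierstrassCurve.Affine.Point.map ι.toRatAlgHom) P = Literature.NumberTheory.EllipticCurves.ModularForms.heegnerPointComplex Dt H → ¬ IsOfFinAddOrder P → ∀ (κ : Literature.NumberTheory.EllipticCurves.ZpExtension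 K 3), κ.IsAnticyclotomic → ∀ (γ : Field.absoluteGaloisGroup K) [Fact (κ.IsTopGenerator γ)] (𝔭 : IsDedekindDomain.HeightOneSpectrum (NumberField.RingOfIntegers K)), ((3 : ℕ) : NumberField.RingOfIntegers K) ∈ 𝔭.asIdeal → 𝔭.asIdeal.ramificationIdx (NumberField.RingOfIntegers ℚ) = 1 → 𝔭.asIdeal.inertiaDeg (NumberField.RingOfIntegers ℚ) = 1 → ∀ (𝔭' : IsDedekindDomain.HeightOneSpectrum (NumberField.RingOfIntegers K)), ((3 : ℕ) : NumberField.RingOfIntegers K) ∈ 𝔭'.asIdeal → 𝔭' ≠ 𝔭 → ∀ (ι' : PadicAlgCl 3 ≃+* ℂ), Summit.BirchSwinnertonDyer.BirchSwinnertonDyer.Theorems.SchneiderFree.BranchInducesPrime 3 ι' 𝔭 → ∀ (ΩK : ℂ) (Ωp : ℂ_[3]) (L : Literature.NumberTheory.EllipticCurves.UnrSeries 3), ΩK ≠ 0 → Ωp ≠ 0 → Literature.NumberTheory.EllipticCurves.IsBDPLFunction ι' 𝔭 κ γ Dt.f ΩK Ωp L → Module.IsTorsion (Literature.NumberTheory.EllipticCurves.IwasawaAlgebra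 3) (Summit.BirchSwinnertonDyer.Rank1Residual.X11b.AcSelmer.XAc (W.baseChange K) 3 κ 𝔭' ∅ γ) → ∀ (f : Literature.NumberTheory.EllipticCurves.IwasawaAlgebra 3), Summit.BirchSwinnertonDyer.Rank1Residual.X11b.AcSelmer.XAc.charIdeal (W.baseChange K) 3 κ 𝔭' ∅ γ = Ideal.span {f} → ‖((PowerSeries.constantCoeff f : ℤ_[3]) : ℚ_[3])‖ ≤ ‖((PowerSeries.constantCoeff L : Literature.NumberTheory.EllipticCurves.unrIntegers 3) : ℂ_[3])‖)
    (hKoly : WildKolyvaginUpperAtThreeTowerFree)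
    (hW : WildSplitPrintedInputsAtThree)
    (hPT : PoitouTateSelmerStructureDualityFact)
    (hZ : WildRankZeroTwistAtThree) :
    Summit.BirchSwinnertonDyer.WAllExclAddWildRankOneSurj :=
  wAllExclAddWildRankOneSurj_of_valueAtOneRestricted_of_koTowerFree_of_frameOdd_of_poitouTate hF hE1 hKoly hW
    (fun hH hB ↦ wildSplitFrameAtThreeOddOfPrint_proof hH hB) hPT hZ

end Summit.BirchSwinnertonDyer.BirchSwinnertonDyer.Theorems.EisensteinKernelAtThreeTowerFreeOddOfValueAtOne

end
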